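import Mathlib
import HarnessLib
import Literature.Analysis.FluidPDE.VorticityEquation
import Literature.Analysis.FluidPDE.AxisymmetricVorticityTransport
import Literature.Analysis.FluidPDE.TaoEnstrophyLocalisation

/-!
# Route `QuarterLogPincer`, crux `TypeIQuantSubcubicExp` (stmt-NavierStokesRegularity-24077), line `silencing_cost` —
# Sv `VorticityInequality` (CALCULUS): the vorticity of a box-bounded classical solution lies in the inequality class

ns-idea-7's line `Cruxes/TypeIQuantSubcubicExp/Lines/silencing_cost.lean` (v1.1, 338118c44af2; idea-crit-4 g8 PASS
2026-08-29T06:01Z) carries the stub Sv `stub_vorticityInequality : VorticityInequality` (:581, «size M; CALCULUS — the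
bridge from Navier–Stokes to the inequality class»): for `M₁ ≥ 1` there is `B = B(M₁) ≥ 1` such that a classical
solution on `[0, T]` with the `C²` box bound `‖∇ʲu(s, x)‖ ≤ M₁ σ^{-(j+1)}` (`j ≤ 2`) on `[t, t₁] × B(y, ρ)`
(`0 ≤ t < t₁ ≤ T`) has a vorticity `ω = curl u` that is jointly smooth on `[t, t₁] × ℝ³` and satisfies there
`|ω| ≤ Bσ⁻²`, `|∇ω| ≤ Bσ⁻³` and `|∂ₛω − Δω| ≤ Bσ⁻²|ω| + Bσ⁻¹|∇ω|`.  This file proves the statement with its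
binders VERBATIM (the line's `BoxBound M₁ σ u y (Icc t t₁) ρ` UNFOLDED, `E3` spelled out) as the theorem
`vorticityInequality`, with `B := (‖curlCLM‖ + 1) M₁`: the vorticity equation of the restricted classical solution on
`[t, t₁]` (`Literature.Analysis.FluidPDE.IsClassicalNSSolutionOn.isVorticitySolutionOn_zero_force`, Majda–Bertozzi
(2.110): `∂ₛω + (u·∇)ω = (ω·∇)u + Δω`) gives `∂ₛω − Δω = Du·ω − Dω·u`, and `|curl v| ≤ κ‖Dv‖`,
`‖D(curl v)‖ ≤ κ‖D²v‖` (`norm_curl_le`, `norm_fderiv_curl_le`).  Once `def VorticityInequality` has a Theorems home,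
`stub_vorticityInequality := vorticityInequality` closes it by unfolding.

HONEST FRAME: vector calculus for smooth classical solutions; nothing here bears on 24077's truth, W7 or
Navier–Stokes regularity (OPEN / not proved).  pub-ns-dss typer (g38), `--supports stmt-NavierStokesRegularity-24077`.
-/

noncomputable section

set_option linter.dupNamespace false

namespace Summit.NavierStokesRegularity.NavierStokesRegularity.Cruxes.TypeIQuantSubcubicExp.SilencingCost

open MeasureTheory Set Function Filter Topology Metric
open scoped ENNReal NNReal Laplacian RealInnerProductSpace
open Literature.Analysis Literature.Analysis.FluidPDE

/-- **Sv — `VorticityInequality` (the statement of `Lines/silencing_cost.lean` :581, binders verbatim, `BoxBound`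
unfolded): the vorticity of a `C²`-box-bounded classical solution is jointly smooth on the box's time interval and
satisfies the parabolic inequality `|∂ₛω − Δω| ≤ Bσ⁻²|ω| + Bσ⁻¹|∇ω|` with `|ω| ≤ Bσ⁻²`, `|∇ω| ≤ Bσ⁻³`,
`B = (‖curlCLM‖ + 1) M₁`.** -/
theorem vorticityInequality :
    ∀ M₁ : ℝ, 1 ≤ M₁ → ∃ B : ℝ, 1 ≤ B ∧
    ∀ (T : ℝ) (u : ℝ → EuclideanSpace ℝ (Fin 3) → EuclideanSpace ℝ (Fin 3))
      (p : ℝ → EuclideanSpace ℝ (Fin 3) → ℝ), IsClassicalNSSolutionOn (Icc 0 T) 1 0 u p →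
    ∀ (y : EuclideanSpace ℝ (Fin 3)) (σ ρ t t₁ : ℝ), 0 < σ → 0 ≤ t → t < t₁ → t₁ ≤ T →
      (∀ s ∈ Icc t t₁, ∀ x ∈ ball y ρ, ∀ j : ℕ, j ≤ 2 →
        ‖iteratedFDeriv ℝ j (u s) x‖ ≤ M₁ * σ ^ (-((j : ℝ) + 1))) →
      IsSmoothSpaceTimeOn (Icc t t₁) (fun s => curl (u s)) ∧
      ∀ s ∈ Icc t t₁, ∀ x ∈ ball y ρ,
        ‖curl (u s) x‖ ≤ B * σ ^ (-(2 : ℝ)) ∧ ‖fderiv ℝ (curl (u s)) x‖ ≤ B * σ ^ (-(3 : ℝ)) ∧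
        ‖timeDerivWithin (Icc t t₁) (fun s' => curl (u s')) s x - (Δ (curl (u s))) x‖ ≤
          B * σ ^ (-(2 : ℝ)) * ‖curl (u s) x‖ + B * σ ^ (-(1 : ℝ)) * ‖fderiv ℝ (curl (u s)) x‖ := by
  intro M₁ hM₁
  set κ : ℝ := ‖(curlCLM : (EuclideanSpace ℝ (Fin 3) →L[ℝ] EuclideanSpace ℝ (Fin 3)) →L[ℝ]
      EuclideanSpace ℝ (Fin 3))‖ with hκ
  have hκ0 : 0 ≤ κ := by rw [hκ]; positivity
  have hM₁0 : 0 ≤ M₁ := by linarith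
  refine ⟨(κ + 1) * M₁, by nlinarith, ?_⟩
  intro T u p hcl y σ ρ t t₁ hσ ht htt₁ ht₁T hbox
  have hBM : M₁ ≤ (κ + 1) * M₁ := by nlinarith
  have hBκ : κ * M₁ ≤ (κ + 1) * M₁ := by nlinarith
  -- the classical solution restricted to `[t, t₁]`
  have hsub : Icc t t₁ ⊆ Icc 0 T := Icc_subset_Icc ht ht₁T
  have hU : UniqueDiffOn ℝ (Icc t t₁) := uniqueDiffOn_Icc htt₁
  have h' : IsClassicalNSSolutionOn (Icc t t₁) 1 0 u p := hcl.mono hsub hU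
  have hcl' : Icc t t₁ ⊆ closure (interior (Icc t t₁)) := by
    rw [interior_Icc, closure_Ioo htt₁.ne]
  have hvort : IsVorticitySolutionOn (Icc t t₁) 1 u := h'.isVorticitySolutionOn_zero_force hU hcl'
  have hvdef : (fun s => curl (u s)) = vorticity u := rfl
  refine ⟨?_, ?_⟩
  · rw [hvdef]
    exact h'.smooth_velocity.isSmoothSpaceTimeOn_vorticity hU
  intro s hs x hx
  have hsm2 : ContDiff ℝ 2 (u s) := (h'.contDiff_velocity hs).of_le (by norm_cast)
  -- the three box bounds in use
  have h0 : ‖u s x‖ ≤ M₁ * σ ^ (-(1 : ℝ)) := by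
    have h := hbox s hs x hx 0 (by norm_num)
    rw [norm_iteratedFDeriv_zero, Nat.cast_zero, zero_add] at h
    exact h
  have h1 : ‖fderiv ℝ (u s) x‖ ≤ M₁ * σ ^ (-(2 : ℝ)) := by
    have h := hbox s hs x hx 1 (by norm_num)
    rw [← norm_iteratedFDeriv_fderiv, norm_iteratedFDeriv_zero, Nat.cast_one,
      show (-((1 : ℝ) + 1)) = -(2 : ℝ) by norm_num] at h
    exact h
  have h2 : ‖iteratedFDeriv ℝ 2 (u s) x‖ ≤ M₁ * σ ^ (-(3 : ℝ)) := by
    have h := hbox s hs x hx 2 (by norm_num)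
    rw [Nat.cast_ofNat, show (-((2 : ℝ) + 1)) = -(3 : ℝ) by norm_num] at h
    exact h
  have hσ2 : 0 < σ ^ (-(2 : ℝ)) := Real.rpow_pos_of_pos hσ _
  have hσ3 : 0 < σ ^ (-(3 : ℝ)) := Real.rpow_pos_of_pos hσ _
  have hσ1 : 0 < σ ^ (-(1 : ℝ)) := Real.rpow_pos_of_pos hσ _
  -- `|ω| ≤ κ |Du| ≤ B σ⁻²`
  have hω : ‖curl (u s) x‖ ≤ (κ + 1) * M₁ * σ ^ (-(2 : ℝ)) := by
    calc ‖curl (u s) x‖ ≤ κ * ‖fderiv ℝ (u s) x‖ := norm_curl_le (u s) x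
      _ ≤ κ * (M₁ * σ ^ (-(2 : ℝ))) := mul_le_mul_of_nonneg_left h1 hκ0
      _ = κ * M₁ * σ ^ (-(2 : ℝ)) := by ring
      _ ≤ (κ + 1) * M₁ * σ ^ (-(2 : ℝ)) := mul_le_mul_of_nonneg_right hBκ hσ2.le
  -- `|Dω| ≤ κ |D²u| ≤ B σ⁻³`
  have hDω : ‖fderiv ℝ (curl (u s)) x‖ ≤ (κ + 1) * M₁ * σ ^ (-(3 : ℝ)) := by
    calc ‖fderiv ℝ (curl (u s)) x‖ ≤ κ * ‖iteratedFDeriv ℝ 2 (u s) x‖ := norm_fderiv_curl_le hsm2 x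
      _ ≤ κ * (M₁ * σ ^ (-(3 : ℝ))) := mul_le_mul_of_nonneg_left h2 hκ0
      _ = κ * M₁ * σ ^ (-(3 : ℝ)) := by ring
      _ ≤ (κ + 1) * M₁ * σ ^ (-(3 : ℝ)) := mul_le_mul_of_nonneg_right hBκ hσ3.le
  refine ⟨hω, hDω, ?_⟩
  -- the vorticity equation: `∂ₛω − Δω = Du·ω − Dω·u`
  have heq := hvort.vorticity_eq s hs x
  rw [one_smul] at heq
  have hident : timeDerivWithin (Icc t t₁) (fun s' => curl (u s')) s x - (Δ (curl (u s))) x =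
      convect (vorticity u s) (u s) x - convect (u s) (vorticity u s) x := by
    rw [sub_eq_sub_iff_add_eq_add]
    exact heq
  rw [hident, convect_apply, convect_apply, vorticity_apply]
  calc ‖fderiv ℝ (u s) x (curl (u s) x) - fderiv ℝ (curl (u s)) x (u s x)‖
      ≤ ‖fderiv ℝ (u s) x (curl (u s) x)‖ + ‖fderiv ℝ (curl (u s)) x (u s x)‖ := norm_sub_le _ _
    _ ≤ ‖fderiv ℝ (u s) x‖ * ‖curl (u s) x‖ + ‖fderiv ℝ (curl (u s)) x‖ * ‖u s x‖ :=
        add_le_add (ContinuousLinearMap.le_opNorm _ _) (ContinuousLinearMap.le_opNorm _ _)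
    _ ≤ M₁ * σ ^ (-(2 : ℝ)) * ‖curl (u s) x‖ + ‖fderiv ℝ (curl (u s)) x‖ * (M₁ * σ ^ (-(1 : ℝ))) :=
        add_le_add (mul_le_mul_of_nonneg_right h1 (norm_nonneg _))
          (mul_le_mul_of_nonneg_left h0 (norm_nonneg _))
    _ = M₁ * σ ^ (-(2 : ℝ)) * ‖curl (u s) x‖ + M₁ * σ ^ (-(1 : ℝ)) * ‖fderiv ℝ (curl (u s)) x‖ := by ring
    _ ≤ (κ + 1) * M₁ * σ ^ (-(2 : ℝ)) * ‖curl (u s) x‖ +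
          (κ + 1) * M₁ * σ ^ (-(1 : ℝ)) * ‖fderiv ℝ (curl (u s)) x‖ := by
        gcongr

end Summit.NavierStokesRegularity.NavierStokesRegularity.Cruxes.TypeIQuantSubcubicExp.SilencingCost

end
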